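import Literature.NumberTheory.Automorphic.UnitaryResiduallyRegularOrbitalIntegral    -- ★ p838979∕p839174 (A-p01 (g19)): §2∕§2′ unitary heads with binders `hK1`∕`hcore`
import Literature.NumberTheory.Automorphic.GLnResiduallyRegularConjugacy               -- ★ p839293 (B-p14 (g29), D-S3c (c3)): `GLn.forall_exists_mem_glInt_conj_eq_of_isConj`
import Literature.NumberTheory.Automorphic.GLnResiduallyRegularCentralizerCompactCore  -- ★ p839376 (B-p14 (g29), D-S3c (c4)): `GLn.setOf_mem_glInt_eq_compactCore_centralizer`
import Literature.NumberTheory.Automorphic.UnramifiedIntegralConjugacy                  -- ★ `UnitaryGroup.integralConj_of_mulEquiv` (§1 (t1) docks on it)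
import Literature.NumberTheory.Automorphic.UnitaryGroupSplitPlace                       -- ★ `localSplitEquiv : U(H)(L⁺_v) ≃ₜ* GL_N(L_w)` at a split place
import Literature.NumberTheory.Automorphic.LocalUnitaryIntegralLevel                    -- ★ `mem_localIntegralLevel_iff_of_ne`, `cmLocalIntegralLevel`
import Literature.NumberTheory.Automorphic.AdicCompletionLocalField                     -- ★ `IsNonarchimedeanLocalField (w.adicCompletion L)`
import Literature.NumberTheory.Automorphic.OrbitalMeasureCanonicalExists                -- ★ `compactCore_prod`
import Literature.NumberTheory.Automorphic.CompactCoreCentralizerUnitary                -- ★ `centralizer_prod_singleton`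
import HarnessLib

/-!
# The residually-regular unit orbital integral of the unitary group, CLOSED at a SPLIT place of good reduction:
# `O_γ(1_{U(H)(𝒪_v)}) = vol U(H)(𝒪_v)` with NO arithmetic binder (and the same for the endoscopic pair group)

Topic `NumberTheory/Automorphic`; namespaces `Literature.NumberTheory.Automorphic` (§1) and `….UnitaryGroup` (§3–§4).  THEOREMS ONLY (no definition,
no instance, no notation, no named fact, no `sorry`).  Cell `hodgecm-mathlib`, F0∕P3a road letter «D-S3u ED. 3 — DISCHARGE `hK1` ∕ `hcore` BY NAME»
(LEAD F0P3a-plan (g8) T7-75 ∕ division T7-83; A-p01 (g20)).  HONEST LABEL: HC_CM is proved only modulo the printed citations until rung 0 closes;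
this file proves NO letter and is count-neutral — it is the residually-regular stratum of the unit fundamental lemma N7 (`O_γ(1_K) = 1`,
[Rogawski1990, §4.9 Prop. 4.9.1 (b)]) in CLOSED FORM at the split places of good reduction; consumers: the split-place unit comparison (roads D-N7s ∕
D-S1), which until now carried `hK1`∕`hcore` as hypotheses of ★ p838979 §2 ∕ ★ p839174 §2′ — at a class `c`, `γ_c := out c`, `K = U(H)(𝒪_v)`:
* `hK1 : ∀ γ′ ∈ K, IsConj γ_c γ′ → ∃ k ∈ K, k γ_c k⁻¹ = γ′` — `(G·γ_c) ∩ K` is ONE `K`-class;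
* `hcore : {z ∈ Z(γ_c) | z ∈ K} = compactCore Z(γ_c)` — `Z(γ_c) ∩ K` IS the maximal compact subgroup of the torus.
THEIR `GL_n` SUPPLIERS (Kottwitz 1986, Prop. 7.1): ★ `GLn.forall_exists_mem_glInt_conj_eq_of_isConj` (D-S3c (c3)) kills `hK1` and ★
`GLn.setOf_mem_glInt_eq_compactCore_centralizer` (D-S3c (c4)) kills `hcore` at `(GL_n(E), GL_n(𝒪_E))`, under `hγ : γ ∈ glInt n E`,
`hγs : (charpoly γ).Separable`, `hsep : (charpoly (redMat γ)).Separable` (residual regularity — the ONE predicate used below, on the `GL_N(L_w)`-avatar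
`e γ`; ★ `charpoly_localSplitEquiv` bridges to the matrix of `γ` for a consumer holding `γ` rationally).
* §1 GENERIC TRANSPORT of the two binders (pure algebra ∕ topology, no measure): along `e : G ≃* G′` with `g ∈ K ↔ e g ∈ K′`
  (`forall_exists_conj_eq_of_mulEquiv` — the `hK1`-shape over ★ `UnitaryGroup.integralConj_of_mulEquiv`;
  `setOf_mem_eq_compactCore_centralizer_of_continuousMulEquiv` — ★ `image_compactCore` on the restricted `Z(γ) ≃ₜ* Z(e γ)`), and to PRODUCTS
  (`forall_exists_conj_eq_prod`; `setOf_mem_prod_eq_compactCore_centralizer` — ★ `centralizer_prod_singleton`, ★ `compactCore_prod`).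
* §3 `G = U(H)(L⁺_v) = (cmDatum L N H).Local v` at a place `v` SPLIT in `L` (`c • w ≠ w`, `c` = complex conjugation) of GOOD REDUCTION
  (`H_w ∈ GL_N(𝒪_w)`): along ★ `localSplitEquiv` (the `w`-projection; levels match by ★ `mem_localIntegralLevel_iff_of_ne`; `cmLocalIntegralLevel =
  localIntegralLevel` and `(cmDatum L N H).Local v = ↥(«local» L c N H v)` are `rfl`), §1 ∘ (c3)(c4) discharge `hK1`
  (`forall_exists_mem_cmLocalIntegralLevel_conj_eq_of_split`; cf. ★ `integralConj_of_split`, the RATIONAL `γ ⊗ 1` form) and `hcore`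
  (`setOf_mem_cmLocalIntegralLevel_eq_compactCore_of_split`; `L_w` is a local field, ★ `instIsNonarchimedeanLocalFieldAdicCompletion`); hence the three
  ★ p838979 §2 heads CLOSED: **`classOrbitalIntegral_indicator_cmLocalIntegralLevel_eq_of_isCanonical_of_split`** ∕ `_eq_one_` ∕ `_complex_…_eq_one_`.
* §4 the `H`-side PAIR GROUP `U(H₂)(L⁺_v) × U(H₁)(L⁺_v)`, `K_H = U(H₂)(𝒪_v) ×ˢ U(H₁)(𝒪_v)`, at a place split and of good reduction for both factors:
  §1-products ∘ §3 per factor; the two ★ p839174 §2′ heads CLOSED (**`…_prod_eq_of_isCanonical_of_split`**, `…_complex_…_prod_eq_one_…`).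
NOT HERE: the `GL_n(E)` closed layer (F0P3b-p01's `ResiduallyRegularOrbitalIntegralClosed`, T7-83); the INERT place (A-p03's
`UnitaryResiduallyRegularNonsplitPlace`, T7-85: `hK1` by ★ `integralConj_unitaryGroupOfForm` along ★ `localNonsplitEquiv`, `hcore` by ★
`compactCore_centralizer_subset_of_hom` ∘ ★ (c4) `GLn.subgroup_le_glInt_of_isCompact_of_le_centralizer`); `hγs ⟸ hsep` (both binders kept, as (c4)).

References: [Kottwitz1986] R. Kottwitz, *Stable trace formula: elliptic singular terms*, Math. Ann. 275 (1986), §7 Prop. 7.1, Cor. 7.3;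
[Rogawski1990] §4.1 p. 40, §4.3 p. 43, §4.9 Prop. 4.9.1 (b) p. 54–55; [Tits1979] §3.9; [PlatonovRapinchuk1994] §5.1; [BourbakiGT1] Ch. III §2.
-/

set_option autoImplicit false

noncomputable section

open MeasureTheory Measure Topology Set Filter Function NumberField IsDedekindDomain Literature.MeasureTheory.Group
open scoped ENNReal NNReal Matrix MatrixGroups

namespace Literature.NumberTheory.Automorphic

/-! ## §1 Generic transport of the two binders -/

section TransportAlgebra

variable {G G' : Type*} [Group G] [Group G'] (e : G ≃* G') (K : Subgroup G) (K' : Subgroup G')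
  (hKK' : ∀ g, g ∈ K ↔ e g ∈ K')

include hKK' in
/-- **The single-`K`-class binder `hK1` transports along an isomorphism matching the levels**: if `e : G ≃* G′` has `g ∈ K ↔ e g ∈ K′`
and `(G′·e γ) ∩ K′` is one `K′`-class, then `(G·γ) ∩ K` is one `K`-class (pointwise ★ `UnitaryGroup.integralConj_of_mulEquiv`).
[cite: Kottwitz1986, Prop. 7.1] [cite: PlatonovRapinchuk1994, §5.1] -/
theorem forall_exists_conj_eq_of_mulEquiv {γ : G}
    (h' : ∀ δ' ∈ K', IsConj (e γ) δ' → ∃ k' ∈ K', k' * e γ * k'⁻¹ = δ') :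
    ∀ δ ∈ K, IsConj γ δ → ∃ k ∈ K, k * γ * k⁻¹ = δ := by
  intro δ hδ hγδ
  obtain ⟨x, hx⟩ := isConj_iff.1 hγδ
  exact UnitaryGroup.integralConj_of_mulEquiv e K K' hKK' γ δ
    (h' (e δ) ((hKK' δ).1 hδ) (isConj_iff.2 ⟨e x, by rw [← hx, map_mul, map_mul, map_inv]⟩))

end TransportAlgebra

section TransportTopology

variable {G G' : Type*} [Group G] [Group G'] [TopologicalSpace G] [TopologicalSpace G']
  (e : G ≃ₜ* G') (K : Subgroup G) (K' : Subgroup G') (hKK' : ∀ g, g ∈ K ↔ e g ∈ K')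

include hKK' in
/-- **The compact-core binder `hcore` transports along an isomorphism of topological groups matching the levels**: if `e : G ≃ₜ* G′` has
`g ∈ K ↔ e g ∈ K′` and `Z(e γ) ∩ K′ = compactCore Z(e γ)`, then `Z(γ) ∩ K = compactCore Z(γ)` — `e` restricts to `Z(γ) ≃ₜ* Z(e γ)`, which
carries compact core to compact core (★ `image_compactCore`). [cite: Tits1979, §3.9] [cite: BourbakiGT1, Ch. III §2] -/
theorem setOf_mem_eq_compactCore_centralizer_of_continuousMulEquiv {γ : G}
    (h' : {z' : ↥(Subgroup.centralizer ({e γ} : Set G')) | (z' : G') ∈ K'} = compactCore ↥(Subgroup.centralizer ({e γ} : Set G'))) :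
    {z : ↥(Subgroup.centralizer ({γ} : Set G)) | (z : G) ∈ K} = compactCore ↥(Subgroup.centralizer ({γ} : Set G)) := by
  have hce : ∀ g : G, e g ∈ Subgroup.centralizer ({e γ} : Set G') ↔ g ∈ Subgroup.centralizer ({γ} : Set G) := fun g => by
    rw [Subgroup.mem_centralizer_singleton_iff, Subgroup.mem_centralizer_singleton_iff, ← map_mul, ← map_mul, e.injective.eq_iff]
  let ec : ↥(Subgroup.centralizer ({γ} : Set G)) ≃ₜ* ↥(Subgroup.centralizer ({e γ} : Set G')) :=
    { toFun := fun z => ⟨e z, (hce (z : G)).2 z.2⟩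
      invFun := fun z' => ⟨e.symm z', (hce _).1 (by rw [e.apply_symm_apply]; exact z'.2)⟩
      left_inv := fun z => Subtype.ext (e.symm_apply_apply (z : G))
      right_inv := fun z' => Subtype.ext (e.apply_symm_apply (z' : G'))
      map_mul' := fun z z' => Subtype.ext (map_mul e (z : G) (z' : G))
      continuous_toFun := (e.continuous.comp continuous_subtype_val).subtype_mk _
      continuous_invFun := (e.symm.continuous.comp continuous_subtype_val).subtype_mk _ }
  have himg := image_compactCore ec
  ext z
  simp only [Set.mem_setOf_eq]
  constructor
  · intro hz
    have h1 : ec z ∈ compactCore ↥(Subgroup.centralizer ({e γ} : Set G')) := by rw [← h']; exact (hKK' (z : G)).1 hz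
    rw [← himg] at h1
    obtain ⟨z₀, hz₀, hzz⟩ := h1
    exact ec.injective hzz ▸ hz₀
  · intro hz
    have h1 : ec z ∈ compactCore ↥(Subgroup.centralizer ({e γ} : Set G')) := himg ▸ ⟨z, hz, rfl⟩
    rw [← h'] at h1
    exact (hKK' (z : G)).2 h1

end TransportTopology

section Products

variable {A B : Type*} [Group A] [Group B] (KA : Subgroup A) (KB : Subgroup B)

/-- **`hK1` for a product**: if `(A·a) ∩ K_A` is one `K_A`-class and `(B·b) ∩ K_B` one `K_B`-class, then `((A × B)·(a, b)) ∩ (K_A ×ˢ K_B)` is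
one `K_A ×ˢ K_B`-class (conjugacy in a product is componentwise). [cite: Kottwitz1986, Prop. 7.1] [cite: BourbakiGT1, Ch. III §2] -/
theorem forall_exists_conj_eq_prod {a : A} {b : B}
    (ha : ∀ a' ∈ KA, IsConj a a' → ∃ k ∈ KA, k * a * k⁻¹ = a')
    (hb : ∀ b' ∈ KB, IsConj b b' → ∃ k ∈ KB, k * b * k⁻¹ = b') :
    ∀ p ∈ KA.prod KB, IsConj (a, b) p → ∃ k ∈ KA.prod KB, k * (a, b) * k⁻¹ = p := by
  rintro ⟨a', b'⟩ hp hconj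
  obtain ⟨x, hx⟩ := isConj_iff.1 hconj
  have hxa : x.1 * a * x.1⁻¹ = a' := by simpa using congrArg Prod.fst hx
  have hxb : x.2 * b * x.2⁻¹ = b' := by simpa using congrArg Prod.snd hx
  obtain ⟨ka, hka, hkaeq⟩ := ha a' (Subgroup.mem_prod.1 hp).1 (isConj_iff.2 ⟨x.1, hxa⟩)
  obtain ⟨kb, hkb, hkbeq⟩ := hb b' (Subgroup.mem_prod.1 hp).2 (isConj_iff.2 ⟨x.2, hxb⟩)
  exact ⟨(ka, kb), Subgroup.mem_prod.2 ⟨hka, hkb⟩, Prod.ext (by simpa using hkaeq) (by simpa using hkbeq)⟩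

variable [TopologicalSpace A] [TopologicalSpace B] [IsTopologicalGroup A] [IsTopologicalGroup B]

/-- **`hcore` for a product**: if `Z(a) ∩ K_A = compactCore Z(a)` and `Z(b) ∩ K_B = compactCore Z(b)` then
`Z((a, b)) ∩ (K_A ×ˢ K_B) = compactCore Z((a, b))` — `Z((a, b)) ≃ₜ* Z(a) × Z(b)` (★ `centralizer_prod_singleton`) and the compact core of a
product is the product of the compact cores (★ `compactCore_prod`; cf. ★ `compactCore_centralizer_prodMk_subset`, one inclusion).
[cite: Tits1979, §3.9] [cite: BourbakiGT1, Ch. III §2] -/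
theorem setOf_mem_prod_eq_compactCore_centralizer {a : A} {b : B}
    (ha : {z : ↥(Subgroup.centralizer ({a} : Set A)) | (z : A) ∈ KA} = compactCore ↥(Subgroup.centralizer ({a} : Set A)))
    (hb : {z : ↥(Subgroup.centralizer ({b} : Set B)) | (z : B) ∈ KB} = compactCore ↥(Subgroup.centralizer ({b} : Set B))) :
    {z : ↥(Subgroup.centralizer ({(a, b)} : Set (A × B))) | (z : A × B) ∈ KA.prod KB} =
      compactCore ↥(Subgroup.centralizer ({(a, b)} : Set (A × B))) := by
  let e : ↥(Subgroup.centralizer ({(a, b)} : Set (A × B))) ≃ₜ*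
      ↥(Subgroup.centralizer ({a} : Set A)) × ↥(Subgroup.centralizer ({b} : Set B)) :=
    { toFun := fun z => (⟨z.1.1, ((centralizer_prod_singleton a b).le z.2).1⟩, ⟨z.1.2, ((centralizer_prod_singleton a b).le z.2).2⟩)
      invFun := fun p => ⟨(p.1.1, p.2.1), (centralizer_prod_singleton a b).ge ⟨p.1.2, p.2.2⟩⟩
      left_inv := fun z => rfl
      right_inv := fun p => rfl
      map_mul' := fun z z' => rfl
      continuous_toFun := ((continuous_fst.comp continuous_subtype_val).subtype_mk _).prodMk
        ((continuous_snd.comp continuous_subtype_val).subtype_mk _)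
      continuous_invFun :=
        ((continuous_subtype_val.comp continuous_fst).prodMk (continuous_subtype_val.comp continuous_snd)).subtype_mk _ }
  have himage : compactCore ↥(Subgroup.centralizer ({(a, b)} : Set (A × B))) =
      e ⁻¹' compactCore (↥(Subgroup.centralizer ({a} : Set A)) × ↥(Subgroup.centralizer ({b} : Set B))) := by
    rw [← image_compactCore e, e.injective.preimage_image]
  rw [himage, compactCore_prod, ← ha, ← hb]
  ext z
  simp only [Set.mem_setOf_eq, Set.mem_preimage, Set.mem_prod, Subgroup.mem_prod]
  exact Iff.rfl

end Products

/-! ## §3 The unitary group `U(H)(L⁺_v)` at a SPLIT place of good reduction -/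

namespace UnitaryGroup

open Literature.NumberTheory.Automorphic.IntegralReduction

section Split

variable (L : Type) [Field L] [NumberField L] [IsCMField L] (N : ℕ) (H : Matrix (Fin N) (Fin N) L)
  {v : HeightOneSpectrum (𝓞 ↥(maximalRealSubfield L))}
  (hc : IsCMField.complexConj L ≠ 1) (hH : (H.map (IsCMField.complexConj L))ᵀ = H)
  (w : PlacesOver L v) (hw : IsCMField.complexConj L • w.1 ≠ w.1) (hHw : IsUnit (placeForm H w.1))
  (hHi : hHw.unit ∈ glInt N (w.1.adicCompletion L))

include hHi in
/-- **(u3a) `hK1` FOR `U(H)(𝒪_v)` AT A SPLIT PLACE OF GOOD REDUCTION, DISCHARGED**: for `v` split in `L` (`c • w ≠ w`), `H_w ∈ GL_N(𝒪_w)`, and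
`γ ∈ K_v = U(H)(𝒪_v)` whose `GL_N(L_w)`-avatar `e γ` (`e` = ★ `localSplitEquiv`, the `w`-projection) has residually separable characteristic
polynomial: every `U(H)(L⁺_v)`-conjugate of `γ` in `K_v` is a `K_v`-conjugate — §1 transport of ★ (c3) along `e`, the levels matching by ★
`mem_localIntegralLevel_iff_of_ne`. [cite: Kottwitz1986, Prop. 7.1] [cite: PlatonovRapinchuk1994, §5.1] [cite: Rogawski1990, §4.9 p. 54] -/
theorem forall_exists_mem_cmLocalIntegralLevel_conj_eq_of_split {γ : (cmDatum L N H).Local v}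
    (hγ : γ ∈ cmLocalIntegralLevel L N H v)
    (hsep : (redMat ((localSplitEquiv (IsCMField.complexConj L) H hc hH w hw hHw γ : GL (Fin N) (w.1.adicCompletion L)) :
      Matrix (Fin N) (Fin N) (w.1.adicCompletion L))).charpoly.Separable) :
    ∀ γ' ∈ cmLocalIntegralLevel L N H v, IsConj γ γ' → ∃ k ∈ cmLocalIntegralLevel L N H v, k * γ * k⁻¹ = γ' :=
  forall_exists_conj_eq_of_mulEquiv (localSplitEquiv (IsCMField.complexConj L) H hc hH w hw hHw).toMulEquiv
    (cmLocalIntegralLevel L N H v) (glInt N (w.1.adicCompletion L))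
    (fun g => mem_localIntegralLevel_iff_of_ne (IsCMField.complexConj L) N H hc hH w hw hHw hHi g)
    (GLn.forall_exists_mem_glInt_conj_eq_of_isConj
      ((mem_localIntegralLevel_iff_of_ne (IsCMField.complexConj L) N H hc hH w hw hHw hHi γ).1 hγ) hsep)

include hHi in
/-- **(u3b) `hcore` FOR `U(H)(𝒪_v)` AT A SPLIT PLACE OF GOOD REDUCTION, DISCHARGED**: for `γ ∈ K_v = U(H)(𝒪_v)` whose `GL_N(L_w)`-avatar
`e γ` is residually regular (`hγs`, `hsep`), `Z(γ) ∩ K_v = compactCore Z(γ)` — §1 transport of ★ (c4) along the isomorphism of topological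
groups `e : U(H)(L⁺_v) ≃ₜ* GL_N(L_w)`; `L_w` is a non-archimedean local field (★ `instIsNonarchimedeanLocalFieldAdicCompletion`).
[cite: Kottwitz1986, Prop. 7.1] [cite: Tits1979, §3.9] [cite: Rogawski1990, §4.3 p. 43] -/
theorem setOf_mem_cmLocalIntegralLevel_eq_compactCore_of_split {γ : (cmDatum L N H).Local v}
    (hγ : γ ∈ cmLocalIntegralLevel L N H v)
    (hγs : (((localSplitEquiv (IsCMField.complexConj L) H hc hH w hw hHw γ : GL (Fin N) (w.1.adicCompletion L)) :
      Matrix (Fin N) (Fin N) (w.1.adicCompletion L))).charpoly.Separable)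
    (hsep : (redMat ((localSplitEquiv (IsCMField.complexConj L) H hc hH w hw hHw γ : GL (Fin N) (w.1.adicCompletion L)) :
      Matrix (Fin N) (Fin N) (w.1.adicCompletion L))).charpoly.Separable) :
    {z : ↥(Subgroup.centralizer ({γ} : Set ((cmDatum L N H).Local v))) | (z : (cmDatum L N H).Local v) ∈ cmLocalIntegralLevel L N H v} =
      compactCore ↥(Subgroup.centralizer ({γ} : Set ((cmDatum L N H).Local v))) :=
  setOf_mem_eq_compactCore_centralizer_of_continuousMulEquiv (localSplitEquiv (IsCMField.complexConj L) H hc hH w hw hHw)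
    (cmLocalIntegralLevel L N H v) (glInt N (w.1.adicCompletion L))
    (fun g => mem_localIntegralLevel_iff_of_ne (IsCMField.complexConj L) N H hc hH w hw hHw hHi g)
    (GLn.setOf_mem_glInt_eq_compactCore_centralizer
      ((mem_localIntegralLevel_iff_of_ne (IsCMField.complexConj L) N H hc hH w hw hHw hHi γ).1 hγ) hγs hsep)

variable [MeasurableSpace ((cmDatum L N H).Local v)] [BorelSpace ((cmDatum L N H).Local v)]
  [∀ γ : (cmDatum L N H).Local v, MeasurableSpace ((cmDatum L N H).Local v ⧸ Subgroup.centralizer ({γ} : Set ((cmDatum L N H).Local v)))]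
  [∀ γ : (cmDatum L N H).Local v, BorelSpace ((cmDatum L N H).Local v ⧸ Subgroup.centralizer ({γ} : Set ((cmDatum L N H).Local v)))]
  (ν : Measure ((cmDatum L N H).Local v)) [IsHaarMeasure ν] [ν.IsMulRightInvariant]

include hHi in
/-- **(u3c) THE UNIT ELEMENT OF `U(H)(L⁺_v)` AT A RESIDUALLY REGULAR CLASS, SPLIT PLACE OF GOOD REDUCTION — CLOSED**: for `m` canonical for
`(P, ν)`, a `P`-class `c` with representative `γ_c ∈ K_v = U(H)(𝒪_v)` whose `GL_N(L_w)`-avatar is residually regular (`hγs`, `hsep`):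
**`classOrbitalIntegral m 1_{K_v} c = ν(K_v).toReal`** — ★ p838979 `classOrbitalIntegral_indicator_cmLocalIntegralLevel_eq_of_isCanonical` with `hK1`
≔ (u3a), `hcore` ≔ (u3b). [cite: Rogawski1990, §4.3 p. 43; §4.9 Prop. 4.9.1 (b) p. 55] [cite: Kottwitz1986, Prop. 7.1] -/
theorem classOrbitalIntegral_indicator_cmLocalIntegralLevel_eq_of_isCanonical_of_split
    {P : (cmDatum L N H).Local v → Prop} {m : OrbitalMeasureFamily ((cmDatum L N H).Local v)} (hm : m.IsCanonical P ν)
    (c : ConjClasses ((cmDatum L N H).Local v)) (hPc : P (Quotient.out c))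
    (hγ : (Quotient.out c : (cmDatum L N H).Local v) ∈ cmLocalIntegralLevel L N H v)
    (hγs : (((localSplitEquiv (IsCMField.complexConj L) H hc hH w hw hHw (Quotient.out c) : GL (Fin N) (w.1.adicCompletion L)) :
      Matrix (Fin N) (Fin N) (w.1.adicCompletion L))).charpoly.Separable)
    (hsep : (redMat ((localSplitEquiv (IsCMField.complexConj L) H hc hH w hw hHw (Quotient.out c) : GL (Fin N) (w.1.adicCompletion L)) :
      Matrix (Fin N) (Fin N) (w.1.adicCompletion L))).charpoly.Separable) :
    classOrbitalIntegral m ((cmLocalIntegralLevel L N H v : Set ((cmDatum L N H).Local v)).indicator (1 : (cmDatum L N H).Local v → ℝ)) c =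
      (ν (cmLocalIntegralLevel L N H v)).toReal :=
  classOrbitalIntegral_indicator_cmLocalIntegralLevel_eq_of_isCanonical L N H v ν hm c hPc hγ
    (forall_exists_mem_cmLocalIntegralLevel_conj_eq_of_split L N H hc hH w hw hHw hHi hγ hsep)
    (setOf_mem_cmLocalIntegralLevel_eq_compactCore_of_split L N H hc hH w hw hHw hHi hγ hγs hsep)

include hHi in
/-- **(u3c, normalised) `classOrbitalIntegral m 1_{U(H)(𝒪_v)} c = 1`** at `vol U(H)(𝒪_v) = 1`, split place of good reduction, residually regular
representative in `U(H)(𝒪_v)`. [cite: Rogawski1990, §4.9 Prop. 4.9.1 (b) p. 55] [cite: Kottwitz1986, Prop. 7.1] -/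
theorem classOrbitalIntegral_indicator_cmLocalIntegralLevel_eq_one_of_isCanonical_of_split
    {P : (cmDatum L N H).Local v → Prop} {m : OrbitalMeasureFamily ((cmDatum L N H).Local v)} (hm : m.IsCanonical P ν)
    (c : ConjClasses ((cmDatum L N H).Local v)) (hPc : P (Quotient.out c))
    (hγ : (Quotient.out c : (cmDatum L N H).Local v) ∈ cmLocalIntegralLevel L N H v)
    (hγs : (((localSplitEquiv (IsCMField.complexConj L) H hc hH w hw hHw (Quotient.out c) : GL (Fin N) (w.1.adicCompletion L)) :
      Matrix (Fin N) (Fin N) (w.1.adicCompletion L))).charpoly.Separable)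
    (hsep : (redMat ((localSplitEquiv (IsCMField.complexConj L) H hc hH w hw hHw (Quotient.out c) : GL (Fin N) (w.1.adicCompletion L)) :
      Matrix (Fin N) (Fin N) (w.1.adicCompletion L))).charpoly.Separable)
    (hν : ν (cmLocalIntegralLevel L N H v) = 1) :
    classOrbitalIntegral m ((cmLocalIntegralLevel L N H v : Set ((cmDatum L N H).Local v)).indicator (1 : (cmDatum L N H).Local v → ℝ)) c = 1 :=
  classOrbitalIntegral_indicator_cmLocalIntegralLevel_eq_one_of_isCanonical L N H v ν hm c hPc hγ
    (forall_exists_mem_cmLocalIntegralLevel_conj_eq_of_split L N H hc hH w hw hHw hHi hγ hsep)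
    (setOf_mem_cmLocalIntegralLevel_eq_compactCore_of_split L N H hc hH w hw hHw hHi hγ hγs hsep) hν

include hHi in
/-- **(u3c, the letter's currency) `classOrbitalIntegral m (1_{U(H)(𝒪_v)} : G → ℂ) c = 1`** — the `G`-side summand of ★ `IsLocalUnitTransfer` at a
residually regular class, split place of good reduction, `vol U(H)(𝒪_v) = 1`; NO arithmetic binder left. [cite: Rogawski1990, §4.9 Prop. 4.9.1 (b) p. 55] -/
theorem classOrbitalIntegral_indicator_complex_cmLocalIntegralLevel_eq_one_of_isCanonical_of_split
    {P : (cmDatum L N H).Local v → Prop} {m : OrbitalMeasureFamily ((cmDatum L N H).Local v)} (hm : m.IsCanonical P ν)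
    (c : ConjClasses ((cmDatum L N H).Local v)) (hPc : P (Quotient.out c))
    (hγ : (Quotient.out c : (cmDatum L N H).Local v) ∈ cmLocalIntegralLevel L N H v)
    (hγs : (((localSplitEquiv (IsCMField.complexConj L) H hc hH w hw hHw (Quotient.out c) : GL (Fin N) (w.1.adicCompletion L)) :
      Matrix (Fin N) (Fin N) (w.1.adicCompletion L))).charpoly.Separable)
    (hsep : (redMat ((localSplitEquiv (IsCMField.complexConj L) H hc hH w hw hHw (Quotient.out c) : GL (Fin N) (w.1.adicCompletion L)) :
      Matrix (Fin N) (Fin N) (w.1.adicCompletion L))).charpoly.Separable)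
    (hν : ν (cmLocalIntegralLevel L N H v) = 1) :
    classOrbitalIntegral m ((cmLocalIntegralLevel L N H v : Set ((cmDatum L N H).Local v)).indicator fun _ => (1 : ℂ)) c = 1 :=
  classOrbitalIntegral_indicator_complex_cmLocalIntegralLevel_eq_one_of_isCanonical L N H v ν hm c hPc hγ
    (forall_exists_mem_cmLocalIntegralLevel_conj_eq_of_split L N H hc hH w hw hHw hHi hγ hsep)
    (setOf_mem_cmLocalIntegralLevel_eq_compactCore_of_split L N H hc hH w hw hHw hHi hγ hγs hsep) hν

end Split

/-! ## §4 The endoscopic-side pair group `U(H₂)(L⁺_v) × U(H₁)(L⁺_v)` at a place split and of good reduction for both factors -/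

section SplitPair

variable (L : Type) [Field L] [NumberField L] [IsCMField L] (N₂ N₁ : ℕ) (H₂ : Matrix (Fin N₂) (Fin N₂) L) (H₁ : Matrix (Fin N₁) (Fin N₁) L)
  {v : HeightOneSpectrum (𝓞 ↥(maximalRealSubfield L))}
  (hc : IsCMField.complexConj L ≠ 1) (hH₂ : (H₂.map (IsCMField.complexConj L))ᵀ = H₂) (hH₁ : (H₁.map (IsCMField.complexConj L))ᵀ = H₁)
  (w : PlacesOver L v) (hw : IsCMField.complexConj L • w.1 ≠ w.1)
  (hH₂w : IsUnit (placeForm H₂ w.1)) (hH₁w : IsUnit (placeForm H₁ w.1))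
  (hH₂i : hH₂w.unit ∈ glInt N₂ (w.1.adicCompletion L)) (hH₁i : hH₁w.unit ∈ glInt N₁ (w.1.adicCompletion L))

include hH₂i hH₁i in
/-- **(u4a) `hK1` for `K_H = U(H₂)(𝒪_v) ×ˢ U(H₁)(𝒪_v)` at a place split and of good reduction for both factors, DISCHARGED** at every `γ ∈ K_H`
whose two `GL(L_w)`-avatars are residually separable: (u3a) per factor and §1 `forall_exists_conj_eq_prod`. [cite: Kottwitz1986, Prop. 7.1] [cite: Rogawski1990, §4.9 p. 54] -/
theorem forall_exists_mem_cmLocalIntegralLevel_prod_conj_eq_of_split {γ : (cmDatum L N₂ H₂).Local v × (cmDatum L N₁ H₁).Local v}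
    (hγ : γ ∈ (cmLocalIntegralLevel L N₂ H₂ v).prod (cmLocalIntegralLevel L N₁ H₁ v))
    (hsep₂ : (redMat ((localSplitEquiv (IsCMField.complexConj L) H₂ hc hH₂ w hw hH₂w γ.1 : GL (Fin N₂) (w.1.adicCompletion L)) :
      Matrix (Fin N₂) (Fin N₂) (w.1.adicCompletion L))).charpoly.Separable)
    (hsep₁ : (redMat ((localSplitEquiv (IsCMField.complexConj L) H₁ hc hH₁ w hw hH₁w γ.2 : GL (Fin N₁) (w.1.adicCompletion L)) :
      Matrix (Fin N₁) (Fin N₁) (w.1.adicCompletion L))).charpoly.Separable) :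
    ∀ γ' ∈ (cmLocalIntegralLevel L N₂ H₂ v).prod (cmLocalIntegralLevel L N₁ H₁ v), IsConj γ γ' →
      ∃ k ∈ (cmLocalIntegralLevel L N₂ H₂ v).prod (cmLocalIntegralLevel L N₁ H₁ v), k * γ * k⁻¹ = γ' :=
  forall_exists_conj_eq_prod (cmLocalIntegralLevel L N₂ H₂ v) (cmLocalIntegralLevel L N₁ H₁ v)
    (forall_exists_mem_cmLocalIntegralLevel_conj_eq_of_split L N₂ H₂ hc hH₂ w hw hH₂w hH₂i (Subgroup.mem_prod.1 hγ).1 hsep₂)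
    (forall_exists_mem_cmLocalIntegralLevel_conj_eq_of_split L N₁ H₁ hc hH₁ w hw hH₁w hH₁i (Subgroup.mem_prod.1 hγ).2 hsep₁)

include hH₂i hH₁i in
/-- **(u4b) `hcore` for the pair group at a place split and of good reduction for both factors, DISCHARGED** at every `γ ∈ K_H` whose two
`GL(L_w)`-avatars are residually regular: (u3b) per factor and §1 `setOf_mem_prod_eq_compactCore_centralizer`. [cite: Kottwitz1986, Prop. 7.1] [cite: Tits1979, §3.9] -/
theorem setOf_mem_cmLocalIntegralLevel_prod_eq_compactCore_of_split {γ : (cmDatum L N₂ H₂).Local v × (cmDatum L N₁ H₁).Local v}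
    (hγ : γ ∈ (cmLocalIntegralLevel L N₂ H₂ v).prod (cmLocalIntegralLevel L N₁ H₁ v))
    (hγs₂ : (((localSplitEquiv (IsCMField.complexConj L) H₂ hc hH₂ w hw hH₂w γ.1 : GL (Fin N₂) (w.1.adicCompletion L)) :
      Matrix (Fin N₂) (Fin N₂) (w.1.adicCompletion L))).charpoly.Separable)
    (hsep₂ : (redMat ((localSplitEquiv (IsCMField.complexConj L) H₂ hc hH₂ w hw hH₂w γ.1 : GL (Fin N₂) (w.1.adicCompletion L)) :
      Matrix (Fin N₂) (Fin N₂) (w.1.adicCompletion L))).charpoly.Separable)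
    (hγs₁ : (((localSplitEquiv (IsCMField.complexConj L) H₁ hc hH₁ w hw hH₁w γ.2 : GL (Fin N₁) (w.1.adicCompletion L)) :
      Matrix (Fin N₁) (Fin N₁) (w.1.adicCompletion L))).charpoly.Separable)
    (hsep₁ : (redMat ((localSplitEquiv (IsCMField.complexConj L) H₁ hc hH₁ w hw hH₁w γ.2 : GL (Fin N₁) (w.1.adicCompletion L)) :
      Matrix (Fin N₁) (Fin N₁) (w.1.adicCompletion L))).charpoly.Separable) :
    {z : ↥(Subgroup.centralizer ({γ} : Set ((cmDatum L N₂ H₂).Local v × (cmDatum L N₁ H₁).Local v))) |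
        (z : (cmDatum L N₂ H₂).Local v × (cmDatum L N₁ H₁).Local v) ∈ (cmLocalIntegralLevel L N₂ H₂ v).prod (cmLocalIntegralLevel L N₁ H₁ v)} =
      compactCore ↥(Subgroup.centralizer ({γ} : Set ((cmDatum L N₂ H₂).Local v × (cmDatum L N₁ H₁).Local v))) :=
  setOf_mem_prod_eq_compactCore_centralizer (cmLocalIntegralLevel L N₂ H₂ v) (cmLocalIntegralLevel L N₁ H₁ v)
    (setOf_mem_cmLocalIntegralLevel_eq_compactCore_of_split L N₂ H₂ hc hH₂ w hw hH₂w hH₂i (Subgroup.mem_prod.1 hγ).1 hγs₂ hsep₂)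
    (setOf_mem_cmLocalIntegralLevel_eq_compactCore_of_split L N₁ H₁ hc hH₁ w hw hH₁w hH₁i (Subgroup.mem_prod.1 hγ).2 hγs₁ hsep₁)

variable
  [MeasurableSpace ((cmDatum L N₂ H₂).Local v × (cmDatum L N₁ H₁).Local v)] [BorelSpace ((cmDatum L N₂ H₂).Local v × (cmDatum L N₁ H₁).Local v)]
  [∀ a : (cmDatum L N₂ H₂).Local v × (cmDatum L N₁ H₁).Local v,
    MeasurableSpace (((cmDatum L N₂ H₂).Local v × (cmDatum L N₁ H₁).Local v) ⧸
      Subgroup.centralizer ({a} : Set ((cmDatum L N₂ H₂).Local v × (cmDatum L N₁ H₁).Local v)))]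
  [∀ a : (cmDatum L N₂ H₂).Local v × (cmDatum L N₁ H₁).Local v,
    BorelSpace (((cmDatum L N₂ H₂).Local v × (cmDatum L N₁ H₁).Local v) ⧸
      Subgroup.centralizer ({a} : Set ((cmDatum L N₂ H₂).Local v × (cmDatum L N₁ H₁).Local v)))]
  (νH : Measure ((cmDatum L N₂ H₂).Local v × (cmDatum L N₁ H₁).Local v)) [IsHaarMeasure νH] [νH.IsMulRightInvariant]

include hH₂i hH₁i in
/-- **(u4c) THE UNIT ELEMENT OF THE PAIR GROUP AT A RESIDUALLY REGULAR CLASS, SPLIT PLACE OF GOOD REDUCTION — CLOSED**: for `m_H` canonical for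
`(P, ν_H)` on `U(H₂)(L⁺_v) × U(H₁)(L⁺_v)` and a `P`-class `c` with representative in `K_H = U(H₂)(𝒪_v) ×ˢ U(H₁)(𝒪_v)` whose two `GL(L_w)`-avatars are
residually regular: **`classOrbitalIntegral m_H 1_{K_H} c = ν_H(K_H).toReal`** — ★ p839174 `…_prod_eq_of_isCanonical` with `hK1` ≔ (u4a), `hcore` ≔ (u4b).
[cite: Rogawski1990, §4.3 p. 43; §4.9 Prop. 4.9.1 (b) p. 55] [cite: Kottwitz1986, Prop. 7.1] -/
theorem classOrbitalIntegral_indicator_cmLocalIntegralLevel_prod_eq_of_isCanonical_of_split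
    {P : (cmDatum L N₂ H₂).Local v × (cmDatum L N₁ H₁).Local v → Prop}
    {m : OrbitalMeasureFamily ((cmDatum L N₂ H₂).Local v × (cmDatum L N₁ H₁).Local v)} (hm : m.IsCanonical P νH)
    (c : ConjClasses ((cmDatum L N₂ H₂).Local v × (cmDatum L N₁ H₁).Local v)) (hPc : P (Quotient.out c))
    (hγ : (Quotient.out c : (cmDatum L N₂ H₂).Local v × (cmDatum L N₁ H₁).Local v) ∈
      (cmLocalIntegralLevel L N₂ H₂ v).prod (cmLocalIntegralLevel L N₁ H₁ v))
    (hγs₂ : (((localSplitEquiv (IsCMField.complexConj L) H₂ hc hH₂ w hw hH₂w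
        (Quotient.out c : (cmDatum L N₂ H₂).Local v × (cmDatum L N₁ H₁).Local v).1 : GL (Fin N₂) (w.1.adicCompletion L)) :
      Matrix (Fin N₂) (Fin N₂) (w.1.adicCompletion L))).charpoly.Separable)
    (hsep₂ : (redMat ((localSplitEquiv (IsCMField.complexConj L) H₂ hc hH₂ w hw hH₂w
        (Quotient.out c : (cmDatum L N₂ H₂).Local v × (cmDatum L N₁ H₁).Local v).1 : GL (Fin N₂) (w.1.adicCompletion L)) :
      Matrix (Fin N₂) (Fin N₂) (w.1.adicCompletion L))).charpoly.Separable)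
    (hγs₁ : (((localSplitEquiv (IsCMField.complexConj L) H₁ hc hH₁ w hw hH₁w
        (Quotient.out c : (cmDatum L N₂ H₂).Local v × (cmDatum L N₁ H₁).Local v).2 : GL (Fin N₁) (w.1.adicCompletion L)) :
      Matrix (Fin N₁) (Fin N₁) (w.1.adicCompletion L))).charpoly.Separable)
    (hsep₁ : (redMat ((localSplitEquiv (IsCMField.complexConj L) H₁ hc hH₁ w hw hH₁w
        (Quotient.out c : (cmDatum L N₂ H₂).Local v × (cmDatum L N₁ H₁).Local v).2 : GL (Fin N₁) (w.1.adicCompletion L)) :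
      Matrix (Fin N₁) (Fin N₁) (w.1.adicCompletion L))).charpoly.Separable) :
    classOrbitalIntegral m ((((cmLocalIntegralLevel L N₂ H₂ v).prod (cmLocalIntegralLevel L N₁ H₁ v) :
        Subgroup ((cmDatum L N₂ H₂).Local v × (cmDatum L N₁ H₁).Local v)) : Set ((cmDatum L N₂ H₂).Local v × (cmDatum L N₁ H₁).Local v)).indicator
        (1 : (cmDatum L N₂ H₂).Local v × (cmDatum L N₁ H₁).Local v → ℝ)) c =
      (νH ((cmLocalIntegralLevel L N₂ H₂ v).prod (cmLocalIntegralLevel L N₁ H₁ v))).toReal :=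
  classOrbitalIntegral_indicator_cmLocalIntegralLevel_prod_eq_of_isCanonical L N₂ N₁ H₂ H₁ v νH hm c hPc hγ
    (forall_exists_mem_cmLocalIntegralLevel_prod_conj_eq_of_split L N₂ N₁ H₂ H₁ hc hH₂ hH₁ w hw hH₂w hH₁w hH₂i hH₁i hγ hsep₂ hsep₁)
    (setOf_mem_cmLocalIntegralLevel_prod_eq_compactCore_of_split L N₂ N₁ H₂ H₁ hc hH₂ hH₁ w hw hH₂w hH₁w hH₂i hH₁i hγ hγs₂ hsep₂ hγs₁ hsep₁)

include hH₂i hH₁i in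
/-- **(u4c, the letter's currency) `classOrbitalIntegral m_H (1_{K_H} : G_H → ℂ) c = 1`** at `vol K_H = 1` — the `H`-side `1_{K_H}` of ★
`IsLocalUnitTransfer` at a residually regular class, place split and of good reduction for both factors; NO arithmetic binder left.
[cite: Rogawski1990, §4.9 Prop. 4.9.1 (b) p. 55] [cite: Kottwitz1986, Prop. 7.1] -/
theorem classOrbitalIntegral_indicator_complex_cmLocalIntegralLevel_prod_eq_one_of_isCanonical_of_split
    {P : (cmDatum L N₂ H₂).Local v × (cmDatum L N₁ H₁).Local v → Prop}
    {m : OrbitalMeasureFamily ((cmDatum L N₂ H₂).Local v × (cmDatum L N₁ H₁).Local v)} (hm : m.IsCanonical P νH)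
    (c : ConjClasses ((cmDatum L N₂ H₂).Local v × (cmDatum L N₁ H₁).Local v)) (hPc : P (Quotient.out c))
    (hγ : (Quotient.out c : (cmDatum L N₂ H₂).Local v × (cmDatum L N₁ H₁).Local v) ∈
      (cmLocalIntegralLevel L N₂ H₂ v).prod (cmLocalIntegralLevel L N₁ H₁ v))
    (hγs₂ : (((localSplitEquiv (IsCMField.complexConj L) H₂ hc hH₂ w hw hH₂w
        (Quotient.out c : (cmDatum L N₂ H₂).Local v × (cmDatum L N₁ H₁).Local v).1 : GL (Fin N₂) (w.1.adicCompletion L)) :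
      Matrix (Fin N₂) (Fin N₂) (w.1.adicCompletion L))).charpoly.Separable)
    (hsep₂ : (redMat ((localSplitEquiv (IsCMField.complexConj L) H₂ hc hH₂ w hw hH₂w
        (Quotient.out c : (cmDatum L N₂ H₂).Local v × (cmDatum L N₁ H₁).Local v).1 : GL (Fin N₂) (w.1.adicCompletion L)) :
      Matrix (Fin N₂) (Fin N₂) (w.1.adicCompletion L))).charpoly.Separable)
    (hγs₁ : (((localSplitEquiv (IsCMField.complexConj L) H₁ hc hH₁ w hw hH₁w
        (Quotient.out c : (cmDatum L N₂ H₂).Local v × (cmDatum L N₁ H₁).Local v).2 : GL (Fin N₁) (w.1.adicCompletion L)) :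
      Matrix (Fin N₁) (Fin N₁) (w.1.adicCompletion L))).charpoly.Separable)
    (hsep₁ : (redMat ((localSplitEquiv (IsCMField.complexConj L) H₁ hc hH₁ w hw hH₁w
        (Quotient.out c : (cmDatum L N₂ H₂).Local v × (cmDatum L N₁ H₁).Local v).2 : GL (Fin N₁) (w.1.adicCompletion L)) :
      Matrix (Fin N₁) (Fin N₁) (w.1.adicCompletion L))).charpoly.Separable)
    (hν : νH ((cmLocalIntegralLevel L N₂ H₂ v).prod (cmLocalIntegralLevel L N₁ H₁ v)) = 1) :
    classOrbitalIntegral m ((((cmLocalIntegralLevel L N₂ H₂ v).prod (cmLocalIntegralLevel L N₁ H₁ v) :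
        Subgroup ((cmDatum L N₂ H₂).Local v × (cmDatum L N₁ H₁).Local v)) : Set ((cmDatum L N₂ H₂).Local v × (cmDatum L N₁ H₁).Local v)).indicator
        fun _ => (1 : ℂ)) c = 1 :=
  classOrbitalIntegral_indicator_complex_cmLocalIntegralLevel_prod_eq_one_of_isCanonical L N₂ N₁ H₂ H₁ v νH hm c hPc hγ
    (forall_exists_mem_cmLocalIntegralLevel_prod_conj_eq_of_split L N₂ N₁ H₂ H₁ hc hH₂ hH₁ w hw hH₂w hH₁w hH₂i hH₁i hγ hsep₂ hsep₁)
    (setOf_mem_cmLocalIntegralLevel_prod_eq_compactCore_of_split L N₂ N₁ H₂ H₁ hc hH₂ hH₁ w hw hH₂w hH₁w hH₂i hH₁i hγ hγs₂ hsep₂ hγs₁ hsep₁) hν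

end SplitPair

end UnitaryGroup

end Literature.NumberTheory.Automorphic

end
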